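import Summits.AtomisticToContinuum.Crystallization.Theses.ChessboardParticlePlanes
import Literature.MathematicalPhysics.StatisticalMechanics.MuGroundStateConfiguration
import Mathlib.Analysis.InnerProductSpace.PiL2
import Mathlib.Analysis.Normed.Operator.LinearIsometry

/-!
# Crux-strategist s3 — typed census signatures for `PeriodicWindows` (stmt-AtomisticToContinuum-3240)

Not a skeleton, not registered: the Lean signatures quoted in `STRATEGY-CENSUS-s3.md`
(`## Strengthen`: `RowStructure`; `## Decomposition`: `SixCoordinatedLayers` (T1) and
`ExactOfSixCoordinated` (T2), a cut of the wall `stub_triangularLayers` ≡ item stmt-18045).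
`IsDLHullPoint ρ₀ x Z` bundles the standing hypotheses of `stub_triangularLayers` verbatim
(rooted, rotated-hull point of the ground-state sequence `x`, `ρ₀`-dense, exactly laminar with
gaps `≥ 3/4`, `7/10`-separated, uniformly recurrent).
-/

noncomputable section

namespace Summit.AtomisticToContinuum.Crystallization.Cruxes.PeriodicWindows.StrategistS3

open Literature.MathematicalPhysics.StatisticalMechanics Filter

local notation "E3" => EuclideanSpace ℝ (Fin 3)

/-- The standing hypotheses of `stub_triangularLayers` (item stmt-18045), bundled. -/
def IsDLHullPoint (ρ₀ : ℝ) (x : (N : ℕ) → (Fin N → E3)) (Z : Set E3) : Prop :=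
  (0 : E3) ∈ Z ∧
  (∃ (σ : ℕ → ℕ) (τ : ℕ → E3) (A : ℕ → (E3 ≃ₗᵢ[ℝ] E3)),
      StrictMono σ ∧ ∀ R ε : ℝ, 0 < ε → ∀ᶠ j in Filter.atTop,
        BallMatch ε R 0 (Set.range fun i => A j (x (σ j) i) + τ j) Z) ∧
  (∀ c : E3, ∃ p ∈ Z, dist p c ≤ ρ₀) ∧
  (∀ p ∈ Z, ∀ q ∈ Z, p 2 ≠ q 2 → (3 : ℝ) / 4 ≤ |p 2 - q 2|) ∧
  (∀ p ∈ Z, ∀ q ∈ Z, p ≠ q → (7 : ℝ) / 10 ≤ dist p q) ∧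
  (∀ R ε : ℝ, 0 < ε → ∃ G : ℝ, ∀ w ∈ Z, ∃ g ∈ Z, dist g w ≤ G ∧
      BallMatch ε R 0 ((fun p => p - g) '' Z) Z)

/-- The conclusion of `stub_triangularLayers` for one layer through `p`. -/
def TriangularLayerAt (Z : Set E3) (p : E3) : Prop :=
  ∃ a : ℝ, 0 < a ∧ ∃ u v : E3, u 2 = 0 ∧ v 2 = 0 ∧ ‖u‖ = a ∧ ‖v‖ = a ∧
    inner ℝ u v = a ^ 2 / 2 ∧
    {q | q ∈ Z ∧ q 2 = p 2} = {q | ∃ i j : ℤ, q = p + (i : ℝ) • u + (j : ℝ) • v}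

/-- `## Strengthen` — ROW STRUCTURE (codimension-2 laminarity): `Z` lies on a family of parallel
horizontal lines, any two of which are `≥ 3/4` apart. TRUE for every Barlow stacking at the relaxed
spacing `a ≈ 0.9713` (in-layer row distance `a√3/2 ≈ 0.841`, nearest cross-layer row
`√(0.793² + 0.280²) ≈ 0.841`), unlike the plane-laminarity in several directions refuted for hcp (s2, S7). -/
def RowStructured (Z : Set E3) : Prop :=
  ∃ w : E3, w 2 = 0 ∧ ‖w‖ = 1 ∧ ∀ p ∈ Z, ∀ q ∈ Z,
    (∃ t : ℝ, q - p = t • w) ∨ (3 : ℝ) / 4 ≤ ‖(q - p) - (inner ℝ (q - p) w) • w‖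

/-- S⁺ (strengthening of the in-layer half of the crux): every dense laminar separated recurrent
rotated-hull point of a Lennard-Jones ground-state sequence is row-structured. -/
def RowStructure : Prop :=
  ∀ ρ₀ : ℝ, 0 < ρ₀ → ∀ x : (N : ℕ) → (Fin N → E3), (∀ N, IsGroundState lennardJones (x N)) →
    ∀ Z : Set E3, IsDLHullPoint ρ₀ x Z → RowStructured Z

/-- `## Decomposition`, piece T1 — TOPOLOGICAL SIX-COORDINATION (gapped first shell in every layer):
every point has exactly six in-layer neighbours within `6a/5` and no in-layer neighbour at distance in
`(6a/5, 8a/5)`, for some local spacing `a ∈ [9/10, 1]`. -/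
def SixCoordinatedAt (Z : Set E3) (p : E3) : Prop :=
  ∃ a : ℝ, 9 / 10 ≤ a ∧ a ≤ 1 ∧
    {q | q ∈ Z ∧ q 2 = p 2 ∧ q ≠ p ∧ dist q p ≤ 6 / 5 * a}.ncard = 6 ∧
    ∀ q ∈ Z, q 2 = p 2 → dist q p ≤ 6 / 5 * a ∨ 8 / 5 * a ≤ dist q p

def SixCoordinatedLayers : Prop :=
  ∀ ρ₀ : ℝ, 0 < ρ₀ → ∀ x : (N : ℕ) → (Fin N → E3), (∀ N, IsGroundState lennardJones (x N)) →
    ∀ Z : Set E3, IsDLHullPoint ρ₀ x Z → ∀ p ∈ Z, SixCoordinatedAt Z p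

/-- `## Decomposition`, piece T2 — METRIC EXACTIFICATION (laminar large-tolerance Liouville): a dense
laminar separated recurrent rotated-hull point all of whose layers are six-coordinated has exactly
triangular layers. -/
def ExactOfSixCoordinated : Prop :=
  ∀ ρ₀ : ℝ, 0 < ρ₀ → ∀ x : (N : ℕ) → (Fin N → E3), (∀ N, IsGroundState lennardJones (x N)) →
    ∀ Z : Set E3, IsDLHullPoint ρ₀ x Z → (∀ p ∈ Z, SixCoordinatedAt Z p) → ∀ p ∈ Z, TriangularLayerAt Z p

/-- The wall (item stmt-18045 `TriangularLayers`, bundled form). -/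
def TriangularLayersB : Prop :=
  ∀ ρ₀ : ℝ, 0 < ρ₀ → ∀ x : (N : ℕ) → (Fin N → E3), (∀ N, IsGroundState lennardJones (x N)) →
    ∀ Z : Set E3, IsDLHullPoint ρ₀ x Z → ∀ p ∈ Z, TriangularLayerAt Z p

/-- The cut composes (trivial seam): T1 ∧ T2 ⇒ the wall. -/
theorem triangularLayersB_of_T1_T2 (h1 : SixCoordinatedLayers) (h2 : ExactOfSixCoordinated) :
    TriangularLayersB :=
  fun ρ₀ hρ₀ x hx Z hZ => h2 ρ₀ hρ₀ x hx Z hZ (h1 ρ₀ hρ₀ x hx Z hZ)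

/-- The bundled wall is item stmt-18045 verbatim up to currying. -/
theorem triangularLayers_of_bundled (h : TriangularLayersB) :
    Summit.AtomisticToContinuum.Crystallization.Theses.ChessboardParticlePlanes.TriangularLayers := by
  intro ρ₀ hρ₀ x hx Z h0 hhull hdense hlam hsep hrec
  exact h ρ₀ hρ₀ x hx Z ⟨h0, hhull, hdense, hlam, hsep, hrec⟩

end Summit.AtomisticToContinuum.Crystallization.Cruxes.PeriodicWindows.StrategistS3
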